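import Summits.QuantumFields.YangMills.Theorems.UnitScaleTiltProp7AxialTransporterModulus
import Summits.QuantumFields.YangMills.Theorems.UnitScaleTiltProp7AxialHolderLetterGauge
import Summits.QuantumFields.YangMills.Theorems.UnitScaleTiltProp7LocalAxialGaugeSmallField
import HarnessLib

/-!
# Route `UnitScaleTilt`, crux K1 «MinimiserStabilityRegPr» (stmt-QuantumFields-19200), EX row (5) `h3` (STOREY H), H-ROAD brick **H2b = THE BRIDGE H2 → H7-R, v2: LOCAL GAUGE
# PER CENTRE** (★CHAIR WORD №53 (3)(iii)–(iv), ★★OWNER RECORD 17df ∕ WORD №110 (2): «H2b with `hsf` ON THE BOX only», filed directly as v2).  For each centre `c`, ANY gauge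
# transformation `u` in which the background is a small field ON THE BALL `tdist (e c) · ≤ 12ℓ + 4` (`‖U₀^u(b) − 1‖ ≤ aη` there — print's (3.35) «in a suitable gauge», LOCAL), the
# sup `N_ω` and the WINDOWED PLAIN ½-Hölder modulus of the re-gauged field `Ad_u ω` on the ball `tdist (e c) · ≤ 4ℓ + 1` give H7's COVARIANT letter `hHω` AT `c` for `(U₀, ω)` itself —
# gauge invariance of the transported modulus (H2b-GAUGE ✓`Prop7AxialHolderLetterGauge.norm_transported_sub_gaugeAct_eq`) + the per-centre transporter modulus of `U₀^u` (H2b-WALK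
# ✓`Prop7AxialTransporterModulus.norm_axialT_sub_le_of_smallField_ball`) + the per-centre glue (H2b-GLUE's fibre inequality ✓`Prop7AxialHolderLetterGlue.norm_frobEquiv_symm_conj_sub_conj_le`).
# On the `L³`-fold cover this yields H7-R's cover letter `hHωt` at EVERY member, and in the cover's AXIAL gauge at the centre the small-field clause is DISCHARGED from `RegPr` alone
# (pipeline (i) ✓`Prop7LocalAxialGaugeSmallField`, `a := 48ε₀`).  No global gauge letter anywhere (px13 g16 16:03:30Z ALERT: none exists on few-block members with non-central Polyakov loops).

Cell `ym3-torus` (HUMAN RULING D-0037; rung R3 = SU(2) YM₃ on T³ — NOT d = 4, NOT infinite volume, NOT a mass gap, NOT Clay).  Width seat `ym3-torus-px13` (gen 17; v1.1 by gen 16);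
`--supports stmt-QuantumFields-19200 --as helper`; count-neutral; THEOREMS ONLY (0 `def`, 0 `sorry`, default heartbeats).

NOTATION.  `e = siteEquiv`, `ℓ = L^{K−n}`, `η = ℓ⁻¹`; `ω♭ := toL2S⁻¹ ω : Site → M₂(ℂ)`; the re-gauged field `Ad_u ω := toL2S (x ↦ u(x)·ω♭(x)·u(x)*)`; the transported field at centre `c`,
`T_c[U₀, ω] := toL2S (z ↦ σ_c(z)·ω♭(z)·σ_c(z)*)`, `σ_c = axialT U₀ c` — H7's letter `hHω` is the ½-Hölder modulus of `T_c[U₀, ω]` on the ball `tdist (e c) · ≤ 4ℓ+1`.  Since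
`axialT (U₀^u) c z = u(c)·σ_c(z)·u(z)⁻¹` (✓`axialT_gaugeAct`), `T_c[U₀^u, Ad_u ω] = u(c)·T_c[U₀, ω]·u(c)*`: the letter is gauge invariant (✓`hHω_gaugeAct_iff`), and in the axial gauge AT `c`
(`u = σ_c`) the transporter is trivial and `T_c[U₀, ω] = Ad_{σ_c} ω` on the nose.

WHAT IS PROVED (ns `Summit.QuantumFields.YangMills.Theorems.Prop7AxialHolderBridge`; member `F`, heights `n K`, weight `c₀`).
* §0 `plainModulus_of_window_on_ball` — window removal ON ONE BALL: the windowed (`tdist ≤ ℓ`) plain modulus `H` for pairs of the ball + the sup `N` ⟹ the plain modulus `H + 2N` for all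
  pairs of the ball (px19 g15's ✓`plainModulus_ball_of_window` with the letter asked on the ball only); ★ `hHω_at_of_plain_of_transporter` — H2b-GLUE ✓`hHω_of_plain_of_transporter` AT ONE
  CENTRE (same proof, per-centre hypotheses).
* §1 ★★ `hHω_at_of_localGauge` — ON A MEMBER WITH ROOM `2(12ℓ+5) ≤ sitesPerDir 0`, AT ONE CENTRE `c`, IN ANY LOCAL SMALL-FIELD GAUGE `u`: `PlaqSmall (regThreshold F n K ε₀) U₀`, the
  ball clause `‖U₀^u(b) − 1‖ ≤ aη` for `tdist (e c)(e b₋) ≤ 12ℓ+4`, the sup `N_ω` of `ω`, the windowed plain modulus `H_ω` of `Ad_u ω` on `tdist (e c) · ≤ 4ℓ+1` ⟹ H7's `hHω` AT `c` for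
  `(U₀, ω)` with `H := (H_ω + 2N_ω) + 2√2·(12(48ε₀ + a))·N_ω` (✓`Prop7SolutionHessianSupOfRegPr.norm_covGradT_DL2_le_of_holderLetters`' binder, one centre).
* §2 ★★★ `hHωt_of_localGauge` — AT EVERY MEMBER (no room): `RegPr F n K ε₀ U₀`, the member sup `N_ω`, and for every cover centre `ct` SOME gauge `u` on `F.cover 3` with the ball clause for
  the lifted background `(U₀ ∘ π♭)^u` and the windowed plain modulus of `Ad_u (ω ∘ π)` on `tdist (ẽ ct) · ≤ 4ℓ+1` ⟹ H7-R's `hHωt` binder VERBATIM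
  (✓`Prop7SolutionHessianSupAllMembers.norm_covGradT_DL2_le_of_holderLetters_allMembers`) with the same `H` — §1 on the cover (room ✓`room_cover_three`, `PlaqSmall` ✓`regPr_cover_iff`).
* §3 ★★★ `hHωt_of_axialGauge` — THE AXIAL EDITION, SMALL FIELD DISCHARGED: `RegPr`, the sup, and the windowed plain modulus of `Ad_{σ̃_ct}(ω ∘ π)`, `σ̃_ct = axialT (U₀ ∘ π♭) ct`, at every
  cover centre ⟹ `hHωt` with `H := (H_ω + 2N_ω) + 2√2·(12·(96ε₀))·N_ω` (§2 at `u := σ̃_ct`, ball clause = pipeline (i) ✓`norm_gaugeAct_axialT_sub_one_le_of_ball_cover`, `a = 48ε₀`);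
  ★★ `hHωt_of_window` — the same display read as what it is (`Ad_{σ̃_ct}(ω ∘ π) = T_ct[U₀ ∘ π♭, ω ∘ π]`): `hHωt` WINDOWED to `tdist ≤ ℓ` + the sup ⟹ `hHωt`, constant `H_ω + 2N_ω` (§0 only).
HYP-SAT (★★OWNER RULING №42).  `RegPr`∕`PlaqSmall` = print's (8); the ball clause of §1–§2 is print's LOCAL (3.35) ∕ [Balaban1985RegularSpaces] Thm 1 class and is INHABITED by the axial
gauge at the centre (§3, from `RegPr` alone — no `hThm2S`, no global letter); `N_ω` = H1's sup row (✓`Prop7StoreyHValueRows`); the windowed plain modulus of `Ad_u ω` is H2's letter (A) in the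
local gauge (pipeline (ii), px19 g15 — by ✓`hHω_gaugeAct_iff` H2 may be proved in any gauge representative on the ball); the room of §1 is T1-core's class and is ABSENT from §2–§3.
Conclusions = H7∕H7-R's binder texts; no `Prop` hypothesis restates them.  HONEST SCOPE: assembly (gauge algebra + lattice walk + triangle inequalities); H2 in the local gauge is NOT proved
here; nothing of `h3`, norm_G, EX, 19200 or the rung is proved; the Yang–Mills mass gap is NOT proved.

References: T. Bałaban, CMP **99** (1985) 389–434 [Balaban1985BackgroundPropagators] (Thm 3.1 (3.42) p.397, (3.35) p.396, p.393, p.399 L1–3); CMP **102** (1985) 255–275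
[Balaban1985RegularSpaces] (Thm 1 p.81, (1.29)–(1.32), (1.36) p.82); CMP **96** (1984) 223–250 [Balaban1984PropagatorsII] ((1.40) p.230, (2.15) p.225); CMP **98** (1985) 17–51
[Balaban1985Averaging] ((8)–(9) pp.18–19, pp.24–25); CMP **102** (1985) 277–309 [Balaban1985Variational] ((8) p.278).
-/

set_option autoImplicit false

noncomputable section

open scoped BigOperators Matrix.Norms.L2Operator InnerProductSpace ComplexConjugate

namespace Summit.QuantumFields.YangMills.Theorems.Prop7AxialHolderBridge

open Literature.MathematicalPhysics.QuantumFieldTheory.Balaban1983to89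
open Literature.MathematicalPhysics.QuantumFieldTheory.Balaban1983to89.T3ContinuumYM3Torus
open B10Eq27TorusAxialLog (axialT)
open B4Sect5Torus (TSite tdist tdist_nonneg)
open B9Eq311L2Pairing (WL2)
open B11Eq103H1Complex (SiteL2K)
open T3RegularMinimiser (regThreshold)
open T3PrintedRegularMinimiser (RegPr)
open T3SectALandauChart (eta)
open T4ReTrLipUnitary (plaqSmall_gaugeAct_iff)
open Summit.QuantumFields.YangMills.Theorems.Prop7SectET3Transport (periodsT3 siteEquiv)
open Summit.QuantumFields.YangMills.Theorems.Prop7SectET3HilbertLetters (W₂ frobEquiv toL2S toL2S_apply toL2S_symm_apply)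
open Summit.QuantumFields.YangMills.Theorems.Prop7GaugeCovariancePointwise (norm_frobEquiv_symm_conj_eq)
open Summit.QuantumFields.YangMills.Theorems.Prop7AxialHolderLetterGlue (norm_frobEquiv_symm_conj_sub_conj_le)
open Summit.QuantumFields.YangMills.Theorems.Prop7AxialTransporterModulus (norm_axialT_sub_le_of_smallField_ball)
open Summit.QuantumFields.YangMills.Theorems.Prop7AxialHolderLetterGauge (norm_transported_sub_gaugeAct_eq)
open Summit.QuantumFields.YangMills.Theorems.Prop7LocalAxialGaugeSmallField (norm_gaugeAct_axialT_sub_one_le_of_ball_cover)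
open Summit.QuantumFields.YangMills.Theorems.CoverSites
open Summit.QuantumFields.YangMills.Theorems.Prop7PoissonGradientDecayAllMembers (room_cover_three)
open Summit.QuantumFields.YangMills.Theorems.SmallMembersCoverLift (regPr_cover_iff)

variable (F : T3Family) (n K : ℕ) (c₀ : ℝ)

/-! ## §0 Window removal on one ball; the glue at one centre -/

/-- **WINDOW REMOVAL ON ONE BALL**: the plain ½-Hölder modulus `H` of `ω` for pairs of the ball `tdist x₀ · ≤ R` at distance `≤ ℓ`, and the sup `N` of `ω`, give the plain modulus `H + 2N`
for ALL pairs of the ball (beyond the window `(tdist∕ℓ)^{½} ≥ 1` absorbs `2N`; px19 g15's ✓`Prop7ResolventHolderRowMember.plainModulus_ball_of_window` with the letter hypothesised on the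
ball only). [folklore] -/
theorem plainModulus_of_window_on_ball (ω : SiteL2K ℂ 3 (periodsT3 F K) c₀ W₂) {Nω HA : ℝ} (hN0 : 0 ≤ Nω) (hA0 : 0 ≤ HA)
    (hN : ∀ y : TSite 3 (periodsT3 F K), ‖WL2.equiv ℂ (fun _ : TSite 3 (periodsT3 F K) => c₀) W₂ ω y‖ ≤ Nω)
    (R : ℝ) (x₀ : TSite 3 (periodsT3 F K))
    (hHA : ∀ (y y' : TSite 3 (periodsT3 F K)), tdist (periodsT3 F K) x₀ y ≤ R → tdist (periodsT3 F K) x₀ y' ≤ R → tdist (periodsT3 F K) y y' ≤ (F.L : ℝ) ^ (K - n) →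
      ‖WL2.equiv ℂ (fun _ : TSite 3 (periodsT3 F K) => c₀) W₂ ω y' - WL2.equiv ℂ (fun _ : TSite 3 (periodsT3 F K) => c₀) W₂ ω y‖
        ≤ HA * (tdist (periodsT3 F K) y y' / ((F.L : ℝ) ^ (K - n))) ^ ((1 : ℝ) / 2)) :
    ∀ (y y' : TSite 3 (periodsT3 F K)), tdist (periodsT3 F K) x₀ y ≤ R → tdist (periodsT3 F K) x₀ y' ≤ R →
      ‖WL2.equiv ℂ (fun _ : TSite 3 (periodsT3 F K) => c₀) W₂ ω y' - WL2.equiv ℂ (fun _ : TSite 3 (periodsT3 F K) => c₀) W₂ ω y‖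
        ≤ (HA + 2 * Nω) * (tdist (periodsT3 F K) y y' / ((F.L : ℝ) ^ (K - n))) ^ ((1 : ℝ) / 2) := by
  intro y y' hy hy'
  have hL0 : (0 : ℝ) < F.L := by exact_mod_cast (lt_trans zero_lt_one F.hL.2)
  have hl : (0 : ℝ) < (F.L : ℝ) ^ (K - n) := pow_pos hL0 _
  have hr0 : 0 ≤ (tdist (periodsT3 F K) y y' / ((F.L : ℝ) ^ (K - n))) ^ ((1 : ℝ) / 2) :=
    Real.rpow_nonneg (div_nonneg (tdist_nonneg _ _ _) hl.le) _
  by_cases hd : tdist (periodsT3 F K) y y' ≤ (F.L : ℝ) ^ (K - n)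
  · calc _ ≤ HA * (tdist (periodsT3 F K) y y' / ((F.L : ℝ) ^ (K - n))) ^ ((1 : ℝ) / 2) := hHA y y' hy hy' hd
      _ ≤ (HA + 2 * Nω) * (tdist (periodsT3 F K) y y' / ((F.L : ℝ) ^ (K - n))) ^ ((1 : ℝ) / 2) := by
          apply mul_le_mul_of_nonneg_right _ hr0; linarith
  · have hr1 : 1 ≤ (tdist (periodsT3 F K) y y' / ((F.L : ℝ) ^ (K - n))) ^ ((1 : ℝ) / 2) :=
      Real.one_le_rpow ((one_le_div hl).2 (le_of_lt (not_le.1 hd))) (by norm_num)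
    calc _ ≤ ‖WL2.equiv ℂ (fun _ : TSite 3 (periodsT3 F K) => c₀) W₂ ω y'‖ + ‖WL2.equiv ℂ (fun _ : TSite 3 (periodsT3 F K) => c₀) W₂ ω y‖ := norm_sub_le _ _
      _ ≤ Nω + Nω := add_le_add (hN y') (hN y)
      _ = (2 * Nω) * 1 := by ring
      _ ≤ (HA + 2 * Nω) * (tdist (periodsT3 F K) y y' / ((F.L : ℝ) ^ (K - n))) ^ ((1 : ℝ) / 2) :=
          mul_le_mul (by linarith) hr1 zero_le_one (by linarith)

/-- ★ **H2b-GLUE AT ONE CENTRE**: for a background `U`, a field `ω`, a centre `c`: the sup `N_ω`, the plain modulus `H` of `ω` on the ball `tdist (e c) · ≤ 4ℓ+1` and the modulus `Λ` of the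
axial transporter `σ_c = axialT U c` there ⟹ the modulus of the transported field `σ_c ω♭ σ_c*` on that ball with constant `H + 2√2·Λ·N_ω` (✓`Prop7AxialHolderLetterGlue.hHω_of_plain_of_transporter`
with its three hypotheses and its conclusion read at the one centre `c`; proof = its proof: ✓`norm_frobEquiv_symm_conj_sub_conj_le` pointwise).
[cite: Balaban1985BackgroundPropagators, (3.35) p.396, p.393; Balaban1985Averaging, (18) p.21, p.24] -/
theorem hHω_at_of_plain_of_transporter (U : GaugeField (F.P K) 0 (Matrix.specialUnitaryGroup (Fin 2) ℂ)) (ω : SiteL2K ℂ 3 (periodsT3 F K) c₀ W₂) (c : Site (F.P K) 0)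
    {Nω H Λ : ℝ} (hΛ0 : 0 ≤ Λ)
    (hN : ∀ y : TSite 3 (periodsT3 F K), ‖WL2.equiv ℂ (fun _ : TSite 3 (periodsT3 F K) => c₀) W₂ ω y‖ ≤ Nω)
    (hH : ∀ (y y' : TSite 3 (periodsT3 F K)),
      tdist (periodsT3 F K) (siteEquiv F K c) y ≤ 4 * (F.L : ℝ) ^ (K - n) + 1 → tdist (periodsT3 F K) (siteEquiv F K c) y' ≤ 4 * (F.L : ℝ) ^ (K - n) + 1 →
      ‖WL2.equiv ℂ (fun _ : TSite 3 (periodsT3 F K) => c₀) W₂ ω y' - WL2.equiv ℂ (fun _ : TSite 3 (periodsT3 F K) => c₀) W₂ ω y‖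
        ≤ H * (tdist (periodsT3 F K) y y' / ((F.L : ℝ) ^ (K - n))) ^ ((1 : ℝ) / 2))
    (hΛ : ∀ (y y' : TSite 3 (periodsT3 F K)),
      tdist (periodsT3 F K) (siteEquiv F K c) y ≤ 4 * (F.L : ℝ) ^ (K - n) + 1 → tdist (periodsT3 F K) (siteEquiv F K c) y' ≤ 4 * (F.L : ℝ) ^ (K - n) + 1 →
      ‖((axialT U c ((siteEquiv F K).symm y') : Matrix.specialUnitaryGroup (Fin 2) ℂ) : Matrix (Fin 2) (Fin 2) ℂ)
          - ((axialT U c ((siteEquiv F K).symm y) : Matrix.specialUnitaryGroup (Fin 2) ℂ) : Matrix (Fin 2) (Fin 2) ℂ)‖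
        ≤ Λ * (tdist (periodsT3 F K) y y' / ((F.L : ℝ) ^ (K - n))) ^ ((1 : ℝ) / 2)) :
    ∀ (y y' : TSite 3 (periodsT3 F K)),
      tdist (periodsT3 F K) (siteEquiv F K c) y ≤ 4 * (F.L : ℝ) ^ (K - n) + 1 → tdist (periodsT3 F K) (siteEquiv F K c) y' ≤ 4 * (F.L : ℝ) ^ (K - n) + 1 →
      ‖WL2.equiv ℂ (fun _ : TSite 3 (periodsT3 F K) => c₀) W₂
            (toL2S F K c₀ (fun z => ((axialT U c z : Matrix.specialUnitaryGroup (Fin 2) ℂ) : Matrix (Fin 2) (Fin 2) ℂ) * (toL2S F K c₀).symm ω z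
              * star ((axialT U c z : Matrix.specialUnitaryGroup (Fin 2) ℂ) : Matrix (Fin 2) (Fin 2) ℂ))) y'
          - WL2.equiv ℂ (fun _ : TSite 3 (periodsT3 F K) => c₀) W₂
            (toL2S F K c₀ (fun z => ((axialT U c z : Matrix.specialUnitaryGroup (Fin 2) ℂ) : Matrix (Fin 2) (Fin 2) ℂ) * (toL2S F K c₀).symm ω z
              * star ((axialT U c z : Matrix.specialUnitaryGroup (Fin 2) ℂ) : Matrix (Fin 2) (Fin 2) ℂ))) y‖
        ≤ (H + 2 * Real.sqrt 2 * Λ * Nω) * (tdist (periodsT3 F K) y y' / ((F.L : ℝ) ^ (K - n))) ^ ((1 : ℝ) / 2) := by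
  intro y y' hy hy'
  rw [toL2S_apply, toL2S_apply]
  have hval : ∀ t : TSite 3 (periodsT3 F K), (frobEquiv.symm ((toL2S F K c₀).symm ω ((siteEquiv F K).symm t)) : W₂)
      = WL2.equiv ℂ (fun _ : TSite 3 (periodsT3 F K) => c₀) W₂ ω t := fun t => by
    rw [toL2S_symm_apply, Equiv.apply_symm_apply, LinearEquiv.symm_apply_apply]
  set s : ℝ := (tdist (periodsT3 F K) y y' / ((F.L : ℝ) ^ (K - n))) ^ ((1 : ℝ) / 2) with hsdef
  have hs0 : 0 ≤ s := by
    have hℓ : (0 : ℝ) ≤ (F.L : ℝ) ^ (K - n) := by positivity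
    exact Real.rpow_nonneg (div_nonneg (tdist_nonneg _ _ _) hℓ) _
  refine (norm_frobEquiv_symm_conj_sub_conj_le _ _ _ _).trans ?_
  rw [hval, hval]
  have h1 := hH y y' hy hy'
  have h2 := hΛ y y' hy hy'
  have h3 := hN y
  calc ‖WL2.equiv ℂ (fun _ : TSite 3 (periodsT3 F K) => c₀) W₂ ω y' - WL2.equiv ℂ (fun _ : TSite 3 (periodsT3 F K) => c₀) W₂ ω y‖
        + 2 * Real.sqrt 2 * ‖((axialT U c ((siteEquiv F K).symm y') : Matrix.specialUnitaryGroup (Fin 2) ℂ) : Matrix (Fin 2) (Fin 2) ℂ)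
            - ((axialT U c ((siteEquiv F K).symm y) : Matrix.specialUnitaryGroup (Fin 2) ℂ) : Matrix (Fin 2) (Fin 2) ℂ)‖
          * ‖WL2.equiv ℂ (fun _ : TSite 3 (periodsT3 F K) => c₀) W₂ ω y‖
      ≤ H * s + 2 * Real.sqrt 2 * (Λ * s) * Nω :=
        add_le_add h1 (mul_le_mul (mul_le_mul_of_nonneg_left h2 (by positivity)) h3 (norm_nonneg _) (by positivity))
    _ = (H + 2 * Real.sqrt 2 * Λ * Nω) * s := by ring

/-! ## §1 ★★ The bridge at one centre, in any local small-field gauge -/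

/-- ★★ **THE BRIDGE AT ONE CENTRE IN A LOCAL SMALL-FIELD GAUGE.**  On a member with the no-wrap room `2(12ℓ+5) ≤ sitesPerDir 0`, at a centre `c`, for `PlaqSmall (regThreshold F n K ε₀) U₀`
(`0 ≤ ε₀`) and ANY gauge transformation `u` with the LOCAL small-field clause `‖U₀^u(b) − 1‖ ≤ a·η` for `tdist (e c) (e b₋) ≤ 12ℓ + 4` (`0 ≤ a`): the sup `N_ω` of `ω` and the WINDOWED plain
½-Hölder modulus `H_ω` of the re-gauged field `Ad_u ω = toL2S (x ↦ u(x)·ω♭(x)·u(x)*)` on the ball `tdist (e c) · ≤ 4ℓ + 1` give H7's covariant letter `hHω` AT `c` for `(U₀, ω)` itself,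
with `H := (H_ω + 2N_ω) + 2√2·(12(48ε₀ + a))·N_ω`.  PROOF: `PlaqSmall` is gauge invariant (lit ✓`plaqSmall_gaugeAct_iff`); H2b-WALK ✓`norm_axialT_sub_le_of_smallField_ball` gives the modulus
of `axialT (U₀^u) c`; `Ad_u` preserves the pointwise fibre norm (✓`norm_frobEquiv_symm_conj_eq`), so §0 removes the window; §0's glue gives the transported modulus for `(U₀^u, Ad_u ω)`; H2b-GAUGE
✓`norm_transported_sub_gaugeAct_eq` identifies it with that of `(U₀, ω)`. [cite: Balaban1985BackgroundPropagators, (3.35) p.396, p.393, Thm 3.1 (3.42) p.397; Balaban1985RegularSpaces, Thm 1 p.81,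
(1.36) p.82; Balaban1985Averaging, (8) p.19, pp.24-25] -/
theorem hHω_at_of_localGauge {ε₀ a : ℝ} (hε₀ : 0 ≤ ε₀) (ha : 0 ≤ a)
    (U₀ : GaugeField (F.P K) 0 (Matrix.specialUnitaryGroup (Fin 2) ℂ)) (hP : PlaqSmall (regThreshold F n K ε₀) U₀)
    (hroom : 2 * (12 * F.L ^ (K - n) + 5) ≤ (F.P K).sitesPerDir 0) (c : Site (F.P K) 0)
    (u : GaugeTransf (F.P K) 0 (Matrix.specialUnitaryGroup (Fin 2) ℂ))
    (hsf : ∀ b : PBond (F.P K) 0, tdist (periodsT3 F K) (siteEquiv F K c) (siteEquiv F K b.src) ≤ 12 * (F.L : ℝ) ^ (K - n) + 4 →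
      ‖((GaugeField.gaugeAct u U₀ b : Matrix.specialUnitaryGroup (Fin 2) ℂ) : Matrix (Fin 2) (Fin 2) ℂ) - 1‖ ≤ a * eta F n K)
    (ω : SiteL2K ℂ 3 (periodsT3 F K) c₀ W₂) {Nω Hω : ℝ} (hNω0 : 0 ≤ Nω) (hHω0 : 0 ≤ Hω)
    (hN : ∀ y : TSite 3 (periodsT3 F K), ‖WL2.equiv ℂ (fun _ : TSite 3 (periodsT3 F K) => c₀) W₂ ω y‖ ≤ Nω)
    (hHωA : ∀ (y y' : TSite 3 (periodsT3 F K)),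
      tdist (periodsT3 F K) (siteEquiv F K c) y ≤ 4 * (F.L : ℝ) ^ (K - n) + 1 → tdist (periodsT3 F K) (siteEquiv F K c) y' ≤ 4 * (F.L : ℝ) ^ (K - n) + 1 →
      tdist (periodsT3 F K) y y' ≤ (F.L : ℝ) ^ (K - n) →
      ‖WL2.equiv ℂ (fun _ : TSite 3 (periodsT3 F K) => c₀) W₂
            (toL2S F K c₀ (fun x => ((u x : Matrix.specialUnitaryGroup (Fin 2) ℂ) : Matrix (Fin 2) (Fin 2) ℂ) * (toL2S F K c₀).symm ω x
              * star ((u x : Matrix.specialUnitaryGroup (Fin 2) ℂ) : Matrix (Fin 2) (Fin 2) ℂ))) y'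
          - WL2.equiv ℂ (fun _ : TSite 3 (periodsT3 F K) => c₀) W₂
            (toL2S F K c₀ (fun x => ((u x : Matrix.specialUnitaryGroup (Fin 2) ℂ) : Matrix (Fin 2) (Fin 2) ℂ) * (toL2S F K c₀).symm ω x
              * star ((u x : Matrix.specialUnitaryGroup (Fin 2) ℂ) : Matrix (Fin 2) (Fin 2) ℂ))) y‖
        ≤ Hω * (tdist (periodsT3 F K) y y' / ((F.L : ℝ) ^ (K - n))) ^ ((1 : ℝ) / 2)) :
    ∀ (y y' : TSite 3 (periodsT3 F K)),
      tdist (periodsT3 F K) (siteEquiv F K c) y ≤ 4 * (F.L : ℝ) ^ (K - n) + 1 → tdist (periodsT3 F K) (siteEquiv F K c) y' ≤ 4 * (F.L : ℝ) ^ (K - n) + 1 →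
      ‖WL2.equiv ℂ (fun _ : TSite 3 (periodsT3 F K) => c₀) W₂
            (toL2S F K c₀ (fun z => ((axialT U₀ c z : Matrix.specialUnitaryGroup (Fin 2) ℂ) : Matrix (Fin 2) (Fin 2) ℂ) * (toL2S F K c₀).symm ω z
              * star ((axialT U₀ c z : Matrix.specialUnitaryGroup (Fin 2) ℂ) : Matrix (Fin 2) (Fin 2) ℂ))) y'
          - WL2.equiv ℂ (fun _ : TSite 3 (periodsT3 F K) => c₀) W₂
            (toL2S F K c₀ (fun z => ((axialT U₀ c z : Matrix.specialUnitaryGroup (Fin 2) ℂ) : Matrix (Fin 2) (Fin 2) ℂ) * (toL2S F K c₀).symm ω z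
              * star ((axialT U₀ c z : Matrix.specialUnitaryGroup (Fin 2) ℂ) : Matrix (Fin 2) (Fin 2) ℂ))) y‖
        ≤ ((Hω + 2 * Nω) + 2 * Real.sqrt 2 * (12 * (48 * ε₀ + a)) * Nω) * (tdist (periodsT3 F K) y y' / ((F.L : ℝ) ^ (K - n))) ^ ((1 : ℝ) / 2) := by
  -- the re-gauged pair
  set V : GaugeField (F.P K) 0 (Matrix.specialUnitaryGroup (Fin 2) ℂ) := GaugeField.gaugeAct u U₀ with hV
  have hPV : PlaqSmall (regThreshold F n K ε₀) V := (plaqSmall_gaugeAct_iff (regThreshold F n K ε₀) u U₀).mpr hP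
  set ωf : Site (F.P K) 0 → Matrix (Fin 2) (Fin 2) ℂ := (toL2S F K c₀).symm ω with hωf
  set ωu : SiteL2K ℂ 3 (periodsT3 F K) c₀ W₂ := toL2S F K c₀ (fun x => ((u x : Matrix.specialUnitaryGroup (Fin 2) ℂ) : Matrix (Fin 2) (Fin 2) ℂ) * ωf x
      * star ((u x : Matrix.specialUnitaryGroup (Fin 2) ℂ) : Matrix (Fin 2) (Fin 2) ℂ)) with hωu
  -- the transporter of `V` at `c`
  have hΛ := norm_axialT_sub_le_of_smallField_ball F n K hε₀ ha V hPV c hsf hroom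
  -- the sup is gauge invariant pointwise
  have hval : ∀ t : TSite 3 (periodsT3 F K), (frobEquiv.symm (ωf ((siteEquiv F K).symm t)) : W₂) = WL2.equiv ℂ (fun _ : TSite 3 (periodsT3 F K) => c₀) W₂ ω t := fun t => by
    rw [hωf, toL2S_symm_apply, Equiv.apply_symm_apply, LinearEquiv.symm_apply_apply]
  have hNu : ∀ y : TSite 3 (periodsT3 F K), ‖WL2.equiv ℂ (fun _ : TSite 3 (periodsT3 F K) => c₀) W₂ ωu y‖ ≤ Nω := fun y => by
    rw [hωu, toL2S_apply, norm_frobEquiv_symm_conj_eq, hval]; exact hN y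
  -- remove the window on the ball
  have hHu := plainModulus_of_window_on_ball F n K c₀ ωu hNω0 hHω0 hNu (4 * (F.L : ℝ) ^ (K - n) + 1) (siteEquiv F K c) hHωA
  -- glue at `c` for `(V, Ad_u ω)`
  have hglue := hHω_at_of_plain_of_transporter F n K c₀ V ωu c (Nω := Nω) (by positivity) hNu hHu hΛ
  -- read it at `(U₀, ω)`
  intro y y' hy hy'
  have h := hglue y y' hy hy'
  have hsymm : (toL2S F K c₀).symm ωu = fun x => ((u x : Matrix.specialUnitaryGroup (Fin 2) ℂ) : Matrix (Fin 2) (Fin 2) ℂ) * ωf x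
      * star ((u x : Matrix.specialUnitaryGroup (Fin 2) ℂ) : Matrix (Fin 2) (Fin 2) ℂ) := LinearEquiv.symm_apply_apply _ _
  rw [hsymm, hV, norm_transported_sub_gaugeAct_eq F K c₀ u U₀ ωf c y y'] at h
  exact h

/-! ## §2 ★★★ At every member: H7-R's cover letter from local-gauge letters at the cover centres -/

/-- ★★★ **H2b v2 — H7-R's COVER LETTER `hHωt` FROM LOCAL-GAUGE LETTERS, AT EVERY MEMBER** (★CHAIR WORD №53 (3), RECORD 17df).  For `RegPr F n K ε₀ U₀` (`0 ≤ ε₀`, `0 ≤ a`), the member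
sup `N_ω`, and — for every centre `ct` of the `L³`-fold cover — SOME gauge transformation `u` of the cover with the local small-field clause `‖(U₀ ∘ π♭)^u(b̃) − 1‖ ≤ aη` on
`tdist (ẽ ct)(ẽ b̃₋) ≤ 12ℓ+4` and the windowed plain ½-Hölder modulus `H_ω` of `Ad_u (ω ∘ π)` on `tdist (ẽ ct) · ≤ 4ℓ+1`: the `hHωt` binder of
✓`Prop7SolutionHessianSupAllMembers.norm_covGradT_DL2_le_of_holderLetters_allMembers` VERBATIM with `H := (H_ω + 2N_ω) + 2√2·(12(48ε₀ + a))·N_ω` — §1 on `F.cover 3` (room ✓`room_cover_three`,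
`PlaqSmall` ✓`regPr_cover_iff`, the sup lifts along `π`). [cite: Balaban1985BackgroundPropagators, Thm 3.1 (3.42) p.397, p.399 L1–3, (3.35) p.396; Balaban1984PropagatorsII, (2.15) p.225, (1.40) p.230;
Balaban1985RegularSpaces, Thm 1 p.81, (1.36) p.82; Balaban1985Variational, (8) p.278] -/
theorem hHωt_of_localGauge {ε₀ a : ℝ} (hε₀ : 0 ≤ ε₀) (ha : 0 ≤ a)
    (U₀ : GaugeField (F.P K) 0 (Matrix.specialUnitaryGroup (Fin 2) ℂ)) (hreg : RegPr F n K ε₀ U₀)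
    (ω : SiteL2K ℂ 3 (periodsT3 F K) c₀ W₂) {Nω Hω : ℝ} (hNω0 : 0 ≤ Nω) (hHω0 : 0 ≤ Hω)
    (hN : ∀ y : TSite 3 (periodsT3 F K), ‖WL2.equiv ℂ (fun _ : TSite 3 (periodsT3 F K) => c₀) W₂ ω y‖ ≤ Nω)
    (hloc : ∀ ct : Site ((F.cover 3).P K) 0, ∃ u : GaugeTransf ((F.cover 3).P K) 0 (Matrix.specialUnitaryGroup (Fin 2) ℂ),
      (∀ bt : PBond ((F.cover 3).P K) 0,
        tdist (periodsT3 (F.cover 3) K) (siteEquiv (F.cover 3) K ct) (siteEquiv (F.cover 3) K bt.src) ≤ 12 * (F.L : ℝ) ^ (K - n) + 4 →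
        ‖((GaugeField.gaugeAct u (U₀ ∘ projBond (F.P K) 3 0) bt : Matrix.specialUnitaryGroup (Fin 2) ℂ) : Matrix (Fin 2) (Fin 2) ℂ) - 1‖ ≤ a * eta F n K) ∧
      (∀ (yt yt' : TSite 3 (periodsT3 (F.cover 3) K)),
        tdist (periodsT3 (F.cover 3) K) (siteEquiv (F.cover 3) K ct) yt ≤ 4 * (F.L : ℝ) ^ (K - n) + 1 →
        tdist (periodsT3 (F.cover 3) K) (siteEquiv (F.cover 3) K ct) yt' ≤ 4 * (F.L : ℝ) ^ (K - n) + 1 →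
        tdist (periodsT3 (F.cover 3) K) yt yt' ≤ (F.L : ℝ) ^ (K - n) →
        ‖WL2.equiv ℂ (fun _ : TSite 3 (periodsT3 (F.cover 3) K) => c₀) W₂
              (toL2S (F.cover 3) K c₀ (fun xt => ((u xt : Matrix.specialUnitaryGroup (Fin 2) ℂ) : Matrix (Fin 2) (Fin 2) ℂ)
                * (toL2S F K c₀).symm ω (proj (F.P K) 3 0 xt) * star ((u xt : Matrix.specialUnitaryGroup (Fin 2) ℂ) : Matrix (Fin 2) (Fin 2) ℂ))) yt'
            - WL2.equiv ℂ (fun _ : TSite 3 (periodsT3 (F.cover 3) K) => c₀) W₂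
              (toL2S (F.cover 3) K c₀ (fun xt => ((u xt : Matrix.specialUnitaryGroup (Fin 2) ℂ) : Matrix (Fin 2) (Fin 2) ℂ)
                * (toL2S F K c₀).symm ω (proj (F.P K) 3 0 xt) * star ((u xt : Matrix.specialUnitaryGroup (Fin 2) ℂ) : Matrix (Fin 2) (Fin 2) ℂ))) yt‖
          ≤ Hω * (tdist (periodsT3 (F.cover 3) K) yt yt' / ((F.L : ℝ) ^ (K - n))) ^ ((1 : ℝ) / 2))) :
    ∀ (ct : Site ((F.cover 3).P K) 0) (yt yt' : TSite 3 (periodsT3 (F.cover 3) K)),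
      tdist (periodsT3 (F.cover 3) K) (siteEquiv (F.cover 3) K ct) yt ≤ 4 * (F.L : ℝ) ^ (K - n) + 1 →
      tdist (periodsT3 (F.cover 3) K) (siteEquiv (F.cover 3) K ct) yt' ≤ 4 * (F.L : ℝ) ^ (K - n) + 1 →
      ‖WL2.equiv ℂ (fun _ : TSite 3 (periodsT3 (F.cover 3) K) => c₀) W₂
            (toL2S (F.cover 3) K c₀ (fun zt => ((axialT (U₀ ∘ projBond (F.P K) 3 0) ct zt : Matrix.specialUnitaryGroup (Fin 2) ℂ) : Matrix (Fin 2) (Fin 2) ℂ)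
              * (toL2S F K c₀).symm ω (proj (F.P K) 3 0 zt)
              * star ((axialT (U₀ ∘ projBond (F.P K) 3 0) ct zt : Matrix.specialUnitaryGroup (Fin 2) ℂ) : Matrix (Fin 2) (Fin 2) ℂ))) yt'
          - WL2.equiv ℂ (fun _ : TSite 3 (periodsT3 (F.cover 3) K) => c₀) W₂
            (toL2S (F.cover 3) K c₀ (fun zt => ((axialT (U₀ ∘ projBond (F.P K) 3 0) ct zt : Matrix.specialUnitaryGroup (Fin 2) ℂ) : Matrix (Fin 2) (Fin 2) ℂ)
              * (toL2S F K c₀).symm ω (proj (F.P K) 3 0 zt)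
              * star ((axialT (U₀ ∘ projBond (F.P K) 3 0) ct zt : Matrix.specialUnitaryGroup (Fin 2) ℂ) : Matrix (Fin 2) (Fin 2) ℂ))) yt‖
        ≤ ((Hω + 2 * Nω) + 2 * Real.sqrt 2 * (12 * (48 * ε₀ + a)) * Nω) * (tdist (periodsT3 (F.cover 3) K) yt yt' / ((F.L : ℝ) ^ (K - n))) ^ ((1 : ℝ) / 2) := by
  classical
  -- THE COVER: background, plaquettes, room
  set Ut : GaugeField ((F.cover 3).P K) 0 (Matrix.specialUnitaryGroup (Fin 2) ℂ) := U₀ ∘ projBond (F.P K) 3 0 with hUt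
  have hPt : PlaqSmall (regThreshold (F.cover 3) n K ε₀) Ut := ((regPr_cover_iff 3 F ε₀ U₀).mpr hreg).1
  have hroomt : 2 * (12 * (F.cover 3).L ^ (K - n) + 5) ≤ ((F.cover 3).P K).sitesPerDir 0 := room_cover_three F n K
  -- the lifted field and its sup
  set lω : Site (F.P K) 0 → Matrix (Fin 2) (Fin 2) ℂ := (toL2S F K c₀).symm ω with hlω
  set ωt : SiteL2K ℂ 3 (periodsT3 (F.cover 3) K) c₀ W₂ := toL2S (F.cover 3) K c₀ (lω ∘ proj (F.P K) 3 0) with hωt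
  have hωt_apply : ∀ z : TSite 3 (periodsT3 (F.cover 3) K),
      WL2.equiv ℂ (fun _ : TSite 3 (periodsT3 (F.cover 3) K) => c₀) W₂ ωt z
        = WL2.equiv ℂ (fun _ : TSite 3 (periodsT3 F K) => c₀) W₂ ω (siteEquiv F K (proj (F.P K) 3 0 ((siteEquiv (F.cover 3) K).symm z))) := by
    intro z
    have hωl : toL2S F K c₀ lω = ω := (toL2S F K c₀).apply_symm_apply ω
    rw [hωt, toL2S_apply, Function.comp_apply, ← hωl, toL2S_apply, Equiv.symm_apply_apply]
  have hNt : ∀ z, ‖WL2.equiv ℂ (fun _ : TSite 3 (periodsT3 (F.cover 3) K) => c₀) W₂ ωt z‖ ≤ Nω := fun z => by rw [hωt_apply]; exact hN _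
  have hsymm : (toL2S (F.cover 3) K c₀).symm ωt = lω ∘ proj (F.P K) 3 0 := LinearEquiv.symm_apply_apply _ _
  -- per centre: the local gauge, §1 on the cover
  intro ct
  obtain ⟨u, hsf, hA⟩ := hloc ct
  have hA' : ∀ (yt yt' : TSite 3 (periodsT3 (F.cover 3) K)),
      tdist (periodsT3 (F.cover 3) K) (siteEquiv (F.cover 3) K ct) yt ≤ 4 * ((F.cover 3).L : ℝ) ^ (K - n) + 1 →
      tdist (periodsT3 (F.cover 3) K) (siteEquiv (F.cover 3) K ct) yt' ≤ 4 * ((F.cover 3).L : ℝ) ^ (K - n) + 1 →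
      tdist (periodsT3 (F.cover 3) K) yt yt' ≤ ((F.cover 3).L : ℝ) ^ (K - n) →
      ‖WL2.equiv ℂ (fun _ : TSite 3 (periodsT3 (F.cover 3) K) => c₀) W₂
            (toL2S (F.cover 3) K c₀ (fun xt => ((u xt : Matrix.specialUnitaryGroup (Fin 2) ℂ) : Matrix (Fin 2) (Fin 2) ℂ) * (toL2S (F.cover 3) K c₀).symm ωt xt
              * star ((u xt : Matrix.specialUnitaryGroup (Fin 2) ℂ) : Matrix (Fin 2) (Fin 2) ℂ))) yt'
          - WL2.equiv ℂ (fun _ : TSite 3 (periodsT3 (F.cover 3) K) => c₀) W₂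
            (toL2S (F.cover 3) K c₀ (fun xt => ((u xt : Matrix.specialUnitaryGroup (Fin 2) ℂ) : Matrix (Fin 2) (Fin 2) ℂ) * (toL2S (F.cover 3) K c₀).symm ωt xt
              * star ((u xt : Matrix.specialUnitaryGroup (Fin 2) ℂ) : Matrix (Fin 2) (Fin 2) ℂ))) yt‖
        ≤ Hω * (tdist (periodsT3 (F.cover 3) K) yt yt' / (((F.cover 3).L : ℝ) ^ (K - n))) ^ ((1 : ℝ) / 2) := by
    rw [hsymm]; exact hA
  have hcov := hHω_at_of_localGauge (F.cover 3) n K c₀ hε₀ ha Ut hPt hroomt ct u hsf ωt hNω0 hHω0 hNt hA'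
  rw [hsymm] at hcov
  exact hcov

/-! ## §3 ★★★ The axial edition: the small-field clause discharged by pipeline (i) -/

/-- ★★★ **H2b v2, AXIAL EDITION — THE LOCAL SMALL-FIELD CLAUSE DISCHARGED FROM `RegPr`.**  For `RegPr F n K ε₀ U₀` (`0 ≤ ε₀`), the member sup `N_ω`, and at every cover centre `ct` the
windowed plain ½-Hölder modulus `H_ω` of `Ad_{σ̃_ct}(ω ∘ π)` on `tdist (ẽ ct) · ≤ 4ℓ+1`, `σ̃_ct := axialT (U₀ ∘ π♭) ct` the cover's axial gauge AT the centre: H7-R's `hHωt` binder VERBATIM with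
`H := (H_ω + 2N_ω) + 2√2·(12·(48ε₀ + 48ε₀))·N_ω` — §2 at `u := σ̃_ct`, whose ball clause holds with `a := 48ε₀` by pipeline (i) ✓`Prop7LocalAxialGaugeSmallField.norm_gaugeAct_axialT_sub_one_le_of_ball_cover`
(print's axial gauge [Balaban1985Averaging] pp. 24–25, plaquettes only).  (As `σ̃_ct(xt)·ω♭(π xt)·σ̃_ct(xt)*` IS the transported field of `hHωt`, the display is «`hHωt` windowed to `tdist ≤ ℓ`»;
`hHωt_of_window` gives the sharper `H_ω + 2N_ω`.) [cite: Balaban1985Averaging, pp.24-25; Balaban1985BackgroundPropagators, (3.35) p.396, Thm 3.1 (3.42) p.397; Balaban1985Variational, (8) p.278] -/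
theorem hHωt_of_axialGauge {ε₀ : ℝ} (hε₀ : 0 ≤ ε₀)
    (U₀ : GaugeField (F.P K) 0 (Matrix.specialUnitaryGroup (Fin 2) ℂ)) (hreg : RegPr F n K ε₀ U₀)
    (ω : SiteL2K ℂ 3 (periodsT3 F K) c₀ W₂) {Nω Hω : ℝ} (hNω0 : 0 ≤ Nω) (hHω0 : 0 ≤ Hω)
    (hN : ∀ y : TSite 3 (periodsT3 F K), ‖WL2.equiv ℂ (fun _ : TSite 3 (periodsT3 F K) => c₀) W₂ ω y‖ ≤ Nω)
    (hax : ∀ (ct : Site ((F.cover 3).P K) 0) (yt yt' : TSite 3 (periodsT3 (F.cover 3) K)),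
      tdist (periodsT3 (F.cover 3) K) (siteEquiv (F.cover 3) K ct) yt ≤ 4 * (F.L : ℝ) ^ (K - n) + 1 →
      tdist (periodsT3 (F.cover 3) K) (siteEquiv (F.cover 3) K ct) yt' ≤ 4 * (F.L : ℝ) ^ (K - n) + 1 →
      tdist (periodsT3 (F.cover 3) K) yt yt' ≤ (F.L : ℝ) ^ (K - n) →
      ‖WL2.equiv ℂ (fun _ : TSite 3 (periodsT3 (F.cover 3) K) => c₀) W₂
            (toL2S (F.cover 3) K c₀ (fun zt => ((axialT (U₀ ∘ projBond (F.P K) 3 0) ct zt : Matrix.specialUnitaryGroup (Fin 2) ℂ) : Matrix (Fin 2) (Fin 2) ℂ)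
              * (toL2S F K c₀).symm ω (proj (F.P K) 3 0 zt)
              * star ((axialT (U₀ ∘ projBond (F.P K) 3 0) ct zt : Matrix.specialUnitaryGroup (Fin 2) ℂ) : Matrix (Fin 2) (Fin 2) ℂ))) yt'
          - WL2.equiv ℂ (fun _ : TSite 3 (periodsT3 (F.cover 3) K) => c₀) W₂
            (toL2S (F.cover 3) K c₀ (fun zt => ((axialT (U₀ ∘ projBond (F.P K) 3 0) ct zt : Matrix.specialUnitaryGroup (Fin 2) ℂ) : Matrix (Fin 2) (Fin 2) ℂ)
              * (toL2S F K c₀).symm ω (proj (F.P K) 3 0 zt)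
              * star ((axialT (U₀ ∘ projBond (F.P K) 3 0) ct zt : Matrix.specialUnitaryGroup (Fin 2) ℂ) : Matrix (Fin 2) (Fin 2) ℂ))) yt‖
        ≤ Hω * (tdist (periodsT3 (F.cover 3) K) yt yt' / ((F.L : ℝ) ^ (K - n))) ^ ((1 : ℝ) / 2)) :
    ∀ (ct : Site ((F.cover 3).P K) 0) (yt yt' : TSite 3 (periodsT3 (F.cover 3) K)),
      tdist (periodsT3 (F.cover 3) K) (siteEquiv (F.cover 3) K ct) yt ≤ 4 * (F.L : ℝ) ^ (K - n) + 1 →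
      tdist (periodsT3 (F.cover 3) K) (siteEquiv (F.cover 3) K ct) yt' ≤ 4 * (F.L : ℝ) ^ (K - n) + 1 →
      ‖WL2.equiv ℂ (fun _ : TSite 3 (periodsT3 (F.cover 3) K) => c₀) W₂
            (toL2S (F.cover 3) K c₀ (fun zt => ((axialT (U₀ ∘ projBond (F.P K) 3 0) ct zt : Matrix.specialUnitaryGroup (Fin 2) ℂ) : Matrix (Fin 2) (Fin 2) ℂ)
              * (toL2S F K c₀).symm ω (proj (F.P K) 3 0 zt)
              * star ((axialT (U₀ ∘ projBond (F.P K) 3 0) ct zt : Matrix.specialUnitaryGroup (Fin 2) ℂ) : Matrix (Fin 2) (Fin 2) ℂ))) yt'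
          - WL2.equiv ℂ (fun _ : TSite 3 (periodsT3 (F.cover 3) K) => c₀) W₂
            (toL2S (F.cover 3) K c₀ (fun zt => ((axialT (U₀ ∘ projBond (F.P K) 3 0) ct zt : Matrix.specialUnitaryGroup (Fin 2) ℂ) : Matrix (Fin 2) (Fin 2) ℂ)
              * (toL2S F K c₀).symm ω (proj (F.P K) 3 0 zt)
              * star ((axialT (U₀ ∘ projBond (F.P K) 3 0) ct zt : Matrix.specialUnitaryGroup (Fin 2) ℂ) : Matrix (Fin 2) (Fin 2) ℂ))) yt‖
        ≤ ((Hω + 2 * Nω) + 2 * Real.sqrt 2 * (12 * (48 * ε₀ + 48 * ε₀)) * Nω) * (tdist (periodsT3 (F.cover 3) K) yt yt' / ((F.L : ℝ) ^ (K - n))) ^ ((1 : ℝ) / 2) :=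
  hHωt_of_localGauge F n K c₀ hε₀ (by positivity : (0 : ℝ) ≤ 48 * ε₀) U₀ hreg ω hNω0 hHω0 hN fun ct =>
    ⟨axialT (U₀ ∘ projBond (F.P K) 3 0) ct, norm_gaugeAct_axialT_sub_one_le_of_ball_cover F n K hε₀ U₀ hreg ct, hax ct⟩

/-- ★★ **THE SAME DISPLAY READ AS WHAT IT IS**: in the axial gauge at the centre the transporter is trivial — `Ad_{σ̃_ct}(ω ∘ π)` IS the transported field of `hHωt` — so «`hHωt` WINDOWED to
`tdist ≤ ℓ`» + the member sup `N_ω` ⟹ `hHωt` with the sharper constant `H_ω + 2N_ω` (§0's window removal on each cover ball; no `RegPr`, no walk).  Recorded so that the display of pipeline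
(ii) can be chosen freely: H2 in the cover's axial gauge at the centre (small field on the `12ℓ+4` ball by pipeline (i)) delivers exactly this windowed letter.
[cite: Balaban1985BackgroundPropagators, p.399 L1–3, (3.35) p.396; Balaban1984PropagatorsII, (1.40) p.230] -/
theorem hHωt_of_window
    (U₀ : GaugeField (F.P K) 0 (Matrix.specialUnitaryGroup (Fin 2) ℂ))
    (ω : SiteL2K ℂ 3 (periodsT3 F K) c₀ W₂) {Nω Hω : ℝ} (hNω0 : 0 ≤ Nω) (hHω0 : 0 ≤ Hω)
    (hN : ∀ y : TSite 3 (periodsT3 F K), ‖WL2.equiv ℂ (fun _ : TSite 3 (periodsT3 F K) => c₀) W₂ ω y‖ ≤ Nω)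
    (hax : ∀ (ct : Site ((F.cover 3).P K) 0) (yt yt' : TSite 3 (periodsT3 (F.cover 3) K)),
      tdist (periodsT3 (F.cover 3) K) (siteEquiv (F.cover 3) K ct) yt ≤ 4 * (F.L : ℝ) ^ (K - n) + 1 →
      tdist (periodsT3 (F.cover 3) K) (siteEquiv (F.cover 3) K ct) yt' ≤ 4 * (F.L : ℝ) ^ (K - n) + 1 →
      tdist (periodsT3 (F.cover 3) K) yt yt' ≤ (F.L : ℝ) ^ (K - n) →
      ‖WL2.equiv ℂ (fun _ : TSite 3 (periodsT3 (F.cover 3) K) => c₀) W₂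
            (toL2S (F.cover 3) K c₀ (fun zt => ((axialT (U₀ ∘ projBond (F.P K) 3 0) ct zt : Matrix.specialUnitaryGroup (Fin 2) ℂ) : Matrix (Fin 2) (Fin 2) ℂ)
              * (toL2S F K c₀).symm ω (proj (F.P K) 3 0 zt)
              * star ((axialT (U₀ ∘ projBond (F.P K) 3 0) ct zt : Matrix.specialUnitaryGroup (Fin 2) ℂ) : Matrix (Fin 2) (Fin 2) ℂ))) yt'
          - WL2.equiv ℂ (fun _ : TSite 3 (periodsT3 (F.cover 3) K) => c₀) W₂
            (toL2S (F.cover 3) K c₀ (fun zt => ((axialT (U₀ ∘ projBond (F.P K) 3 0) ct zt : Matrix.specialUnitaryGroup (Fin 2) ℂ) : Matrix (Fin 2) (Fin 2) ℂ)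
              * (toL2S F K c₀).symm ω (proj (F.P K) 3 0 zt)
              * star ((axialT (U₀ ∘ projBond (F.P K) 3 0) ct zt : Matrix.specialUnitaryGroup (Fin 2) ℂ) : Matrix (Fin 2) (Fin 2) ℂ))) yt‖
        ≤ Hω * (tdist (periodsT3 (F.cover 3) K) yt yt' / ((F.L : ℝ) ^ (K - n))) ^ ((1 : ℝ) / 2)) :
    ∀ (ct : Site ((F.cover 3).P K) 0) (yt yt' : TSite 3 (periodsT3 (F.cover 3) K)),
      tdist (periodsT3 (F.cover 3) K) (siteEquiv (F.cover 3) K ct) yt ≤ 4 * (F.L : ℝ) ^ (K - n) + 1 →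
      tdist (periodsT3 (F.cover 3) K) (siteEquiv (F.cover 3) K ct) yt' ≤ 4 * (F.L : ℝ) ^ (K - n) + 1 →
      ‖WL2.equiv ℂ (fun _ : TSite 3 (periodsT3 (F.cover 3) K) => c₀) W₂
            (toL2S (F.cover 3) K c₀ (fun zt => ((axialT (U₀ ∘ projBond (F.P K) 3 0) ct zt : Matrix.specialUnitaryGroup (Fin 2) ℂ) : Matrix (Fin 2) (Fin 2) ℂ)
              * (toL2S F K c₀).symm ω (proj (F.P K) 3 0 zt)
              * star ((axialT (U₀ ∘ projBond (F.P K) 3 0) ct zt : Matrix.specialUnitaryGroup (Fin 2) ℂ) : Matrix (Fin 2) (Fin 2) ℂ))) yt'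
          - WL2.equiv ℂ (fun _ : TSite 3 (periodsT3 (F.cover 3) K) => c₀) W₂
            (toL2S (F.cover 3) K c₀ (fun zt => ((axialT (U₀ ∘ projBond (F.P K) 3 0) ct zt : Matrix.specialUnitaryGroup (Fin 2) ℂ) : Matrix (Fin 2) (Fin 2) ℂ)
              * (toL2S F K c₀).symm ω (proj (F.P K) 3 0 zt)
              * star ((axialT (U₀ ∘ projBond (F.P K) 3 0) ct zt : Matrix.specialUnitaryGroup (Fin 2) ℂ) : Matrix (Fin 2) (Fin 2) ℂ))) yt‖
        ≤ (Hω + 2 * Nω) * (tdist (periodsT3 (F.cover 3) K) yt yt' / ((F.L : ℝ) ^ (K - n))) ^ ((1 : ℝ) / 2) := by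
  intro ct
  -- the transported field on the cover and its sup (a pointwise conjugation of the lifted values)
  set Tω : SiteL2K ℂ 3 (periodsT3 (F.cover 3) K) c₀ W₂ := toL2S (F.cover 3) K c₀ (fun zt =>
      ((axialT (U₀ ∘ projBond (F.P K) 3 0) ct zt : Matrix.specialUnitaryGroup (Fin 2) ℂ) : Matrix (Fin 2) (Fin 2) ℂ) * (toL2S F K c₀).symm ω (proj (F.P K) 3 0 zt)
        * star ((axialT (U₀ ∘ projBond (F.P K) 3 0) ct zt : Matrix.specialUnitaryGroup (Fin 2) ℂ) : Matrix (Fin 2) (Fin 2) ℂ)) with hTω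
  have hNT : ∀ z, ‖WL2.equiv ℂ (fun _ : TSite 3 (periodsT3 (F.cover 3) K) => c₀) W₂ Tω z‖ ≤ Nω := fun z => by
    rw [hTω, toL2S_apply, norm_frobEquiv_symm_conj_eq, toL2S_symm_apply, LinearEquiv.symm_apply_apply]
    exact hN _
  exact plainModulus_of_window_on_ball (F.cover 3) n K c₀ Tω hNω0 hHω0 hNT (4 * (F.L : ℝ) ^ (K - n) + 1) (siteEquiv (F.cover 3) K ct) (hax ct)

end Summit.QuantumFields.YangMills.Theorems.Prop7AxialHolderBridge

end
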